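import Summits.CriticalPhenomena.PercolationContinuityZ3.Theorems.PercNearOneGluingNoHeavyQuantHighDimRows
import Literature.Barriers.CriticalPhenomena.KozmaNachmiasLemma51
import HarnessLib

/-!
# (T1) with the SHARP exponent `2` above six dimensions — Kozma–Nachmias's Theorem 2 is now a kernel theorem

PAPER-2 track (i), ARM-3 (the power-law landmark; "mean-field bound transfer for `d > 6`").
builds on p205010 (kernel theorem, internal audit signed; external expert review pending).

The lane's high-dimensional row `Quant.oneArmPolyDecayAtCritical_two_of_kozmaNachmias`
(`…QuantHighDimRows.lean`) gives `π_{p_c}(n) ≤ C n^{-2}` for `d > 6` under the two-point estimate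
`TwoPointBoundedRatio d` (`τ_{p_c}(x,y) ≍ |x−y|^{2−d}`), CONDITIONALLY on the named fact
`KozmaNachmias2011_thm2` (Kozma–Nachmias 2011, Thm. 2 — Chapters 3–5 of the source).  That named fact
is DISCHARGED (`Literature.Barriers.CriticalPhenomena.KozmaNachmias2011_thm2_holds`,
`KozmaNachmiasLemma51.lean`: Lemma 1.1, the regularity Theorem 4, Lemmas 5.1–5.5 and the Chapter-5
assembly are all proved in the barrier catalogue).  This file records the fact-free rows:

* `Quant.oneArmPolyDecayAtCritical_two_of_twoPointBoundedRatio` — `d > 6`, `TwoPointBoundedRatio d`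
  ⊢ `∃ C, OneArmPolyDecayAtCritical d 2 C` (Kozma–Nachmias 2011, Thm. 1, upper bound; the whole
  deduction from the two-point estimate is machine-checked);
* `Quant.oneArmPolyDecay_two_of_twoPointBoundedRatio` — the existential (T1) row with exponent `2`;
* (both bounds `c/n² ≤ π_{p_c}(n) ≤ C/n²` are `Literature.Barriers.CriticalPhenomena.TwoPointBoundedRatio.rhoExHalf`);
* `Quant.oneArmPolyDecayAtCritical_two_of_hara` — `d ≥ 11` granted only Hara's `x`-space
  asymptotics (`Hara2008_etaZeroXSpace`, Heydenreich–van der Hofstad 2017 Thm. 11.4; a named fact).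

Honest: REPRODUCTION of a published theorem; the two-point input (1.2) remains a hypothesis (a theorem
in print for `d ≥ 11`, Fitzner–van der Hofstad 2017 / Hara 2008, not formalised); nothing here bears on
`3 ≤ d ≤ 6`, where the exponent-`2` law is excluded for `d ≤ 5`
(`Quant.oneArmPolyDecayAtCritical_exponent_le_third`).
-/

noncomputable section

namespace Summit.CriticalPhenomena.PercolationContinuityZ3.Theorems.Quant

open Literature.Probability.LatticeModels Literature.Probability.Percolation
  Literature.Barriers.CriticalPhenomena

variable {d : ℕ}

/-- **(T1) with the sharp exponent `2`, fact-free**: for `d > 6` under `TwoPointBoundedRatio d`,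
`∃ C, OneArmPolyDecayAtCritical d 2 C`, i.e. `π_{p_c}(n) ≤ C n^{−2}` for all `n ≥ 1` — Kozma–Nachmias 2011,
Thm. 1 (conditional version), with Thm. 2 now a theorem of the tree (`KozmaNachmias2011_thm2_holds`).
[cite: KozmaNachmias2011, Thm. 1 (conditional version, §1.1) and Thm. 2] -/
theorem oneArmPolyDecayAtCritical_two_of_twoPointBoundedRatio (hd : 6 < d) (hτ : TwoPointBoundedRatio d) :
    ∃ C : ℝ, Quant.OneArmPolyDecayAtCritical d 2 C :=
  oneArmPolyDecayAtCritical_two_of_kozmaNachmias KozmaNachmias2011_thm2_holds hd hτ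

/-- The existential (T1) row with exponent `2` for `d > 6` under `TwoPointBoundedRatio d`.
[cite: KozmaNachmias2011, Thm. 1 (conditional version, §1.1)] -/
theorem oneArmPolyDecay_two_of_twoPointBoundedRatio (hd : 6 < d) (hτ : TwoPointBoundedRatio d) :
    Quant.OneArmPolyDecay d := by
  obtain ⟨C, hC⟩ := oneArmPolyDecayAtCritical_two_of_twoPointBoundedRatio hd hτ
  exact ⟨2, by norm_num, C, hC⟩

/-- **`d ≥ 11`**: the sharp (T1) row granted only Hara's `x`-space asymptotics of the critical two-point
function (Heydenreich–van der Hofstad 2017, Thm. 11.4, the named fact `Hara2008_etaZeroXSpace`), which give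
`TwoPointBoundedRatio d` for `d ≥ 11`. [cite: HeydenreichVanDerHofstad2017, Thm. 11.4 and Thm. 11.5 (11.3.2)] -/
theorem oneArmPolyDecayAtCritical_two_of_hara (h : Hara2008_etaZeroXSpace) (hd : 11 ≤ d) :
    ∃ C : ℝ, Quant.OneArmPolyDecayAtCritical d 2 C :=
  oneArmPolyDecayAtCritical_two_of_twoPointBoundedRatio (by omega) (h.twoPointBoundedRatio hd)

end Summit.CriticalPhenomena.PercolationContinuityZ3.Theorems.Quant

end
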